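import Literature.MathematicalPhysics.QuantumFieldTheory.Balaban1983to89.B2Eq245Theta
import Literature.MathematicalPhysics.QuantumFieldTheory.Balaban1983to89.B2Prop31MinimizerWitness2

/-!
# `Balaban1983to89.B2Eq245ThetaNonzero` — [Balaban1982Higgs2] Prop. 3.1 p. 589 with the cut-offs `θ_k` of p. 567 CONSTRUCTED
(`B2Eq245Theta.RegionsDataN.ofFields`, p23 g13): **the fully constructed datum is inhabited with the (2.55)-type restrictions holding
and a NON-ZERO §3 field** — the one-step case `K = 1` with a constant block field `A₁ ≡ v`, for every torus of the sub-family, every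
large-field configuration `bad`, and every small `v ≠ 0`, at every fine point of `Λ₂^{(0)}` (where `θ₁ = 1`)

statement-level skeleton of published theorems with citation tags; proofs where landed; nothing here is a claim about the Yang–Mills mass gap

CITATION HEADER.  T. Bałaban, *(Higgs)₂,₃ quantum fields in a finite volume. II. An upper bound*, Commun. Math. Phys. **86** (1982) 555–594
[Balaban1982Higgs2], Prop. 3.1 p. 589, (3.2)–(3.3) p. 583, p. 567 (θ_k), Lemma 2.3 p. 571, (2.55) p. 570, (2.8) p. 558.  Cell `lit-balaban`,
Phase-2 proof seat **p23** gen 13 (unit `lit-balaban-p23-g13`; successor of p321142 `B2Eq245Theta`; G-B2-12 addendum, owner ruling r02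
2026-08-22T06:30Z: repair (c₂), `n = 2`).  SKELETON rows **B2.Prop3.1**, **B2.Lem2.3**, **B2.Eq2.44** — CELLS ONLY (owner r02), no head claims.
USED BY NAME, NOTHING RESTATED: p23 g13 `B2Eq245Theta.{thetaOf, thetaOf_eq_one_of_mem, mem_plateau, thetaOf_above, RegionsDataN.ofFields}` (p321142),
`B2Prop31MinimizerRegionsN.{RegionsDataN(.toRMultiMRN), RMultiMRN.{restrictedM, field, A}, radN, exp_neg_delta_radN_le, six_le_radN, L2OfN}` (p320781),
`B2Prop31MinimizerRegionsNonzero.norm_cutMin_const_sub_lt_rad` (p320224), `B2Prop31MinimizerRegions.{towerRad, towerRad_nonneg}` (p319405),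
`B2Eq28RegionsCollars.prime_mono` (p318957), gen-12 `B2Prop31MinimizerWitness.{chargeW, thrQ_nonneg, kappaW, kappaW_nonneg}`, `B2Prop31MinimizerWitness2.thr217M_nonneg`, `B2Prop31MinimizerFamily.
{MinConsts, Lemma23Bounds, exists_lemma23Bounds}`, r14's `B2Lemma23HiggsLattice.cutMin`, p23 g10 `B2Eq32FieldRegularity.{field32, field32_eq_top}`,
`B2Eq244Cutoff.zeta244`, the typer's `B2Eq243RegionsTower.{towerRegion, towerRegion_antitone, towerRegion_blockOf_congr, towerRegion_eq_univ_of_no_bad}`, p15's `prime`/`mem_prime`.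

WHAT THIS MODULE PROVES (kernel-checked, 0 `sorry`, standard axioms; theorems only, no definitions, no `Prop` facts).
 §1 **`ofFields_field_eq_top`**: for the constructed datum with ANY data, where `θ_K(b₋) = 1` the §3 field (3.2) IS the top minimizer
    `a_K(Lᴷε)^{−2}ζ^{(K)}G_KQ_K^*A_K` (3.3) at the radius `ρ_K^{(n)}`; `ofFields_field_plateau` (in particular on `B^{K−1}(Λ₂^{(K−1)})`, p. 567).
 §2 the `K = 1` datum with `A₀ = 0`, `A₁ ≡ v`, `Φ = 0`, `N = 1`, charge `chargeW Γ.e`: **`ofFieldsK1_restrictedM`** (`‖v‖ ≤ c_{A1}(Lε)^{−d/2}p(Lε)` ⇒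
    the printed restrictions `restrictedM`; the θ₂-slice conjunct is vacuous since `θ₂ = 0` above `K = 1`), `ofFieldsK1_field_apply` (on `Λ₂^{(0)}` the
    field is `cutMin … (fun _ ↦ v)`), **`ofFieldsK1_field_ne_zero`** (`v ≠ 0`, `κ·Lε < 1`, `R ≥ (L/n)(2/δ + 2M + 2)`, a fine point in `Λ₂^{(0)}` ⇒ field ≠ 0,
    by p320224's radius-generic Lemma 2.3 with `q = 0` fed with the instance's own `ζ`-clauses/`L2_sub`/`nbhd`).
 §3 **`exists_ofFields_restricted_field_ne_zero`**: packaged `∃ R₁ s₁ > 0 ∀ Q (d, L, a fixed; R ≥ R₁; r ≥ 1) ∀ tori (P.M = M, K ≥ 1, Lε ≤ s₁) ∀ bad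
    ∀ v (small, ≠ 0) ∀ x ∈ Λ₂^{(0)} ∃ D : RegionsDataN n Q Γ M m2` on that torus with `K = 1`, `θ = thetaOf`, `restrictedM` and `field ≠ 0`
    (`1 ≤ n ≤ 2`, `c_θ·M ≥ 1`; `R₁ = (L/n)(2/δ + 2M + 8)` with r14's Lemma-2.3 constant `δ`).
 §4 (v1.1) **EVERY NUMBER OF STEPS `1 ≤ K ≤` the lattice's** with the constant tower of block fields `A_k ≡ v` (`k = 1, …, K`): `ofFieldsConst_restrictedM`
    (`‖v‖ ≤ thrA(Lᵏε)` for `k ≤ K` ⇒ `restrictedM`; the (2.17)-type conjunct on the GENUINE `θ_{j+2}`-slices of the constructed `θ` reads `|v_μ − v_μ| = 0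
    ≤ thr217(L^{j+1}ε)`, gen-12 `thr217M_nonneg`), `ofFieldsConst_field_apply` (on `B^{K−1}(Λ₂^{(K−1)})` the field is the level-`K` minimizer of `v`),
    **`ofFieldsConst_field_ne_zero`** (`v ≠ 0`, `κ·Lᴷε < 1`, a fine point of `B^{K−1}(Λ₂^{(K−1)})` ⇒ field ≠ 0), `ofFieldsConst_field_ne_zero_noBad`
    (`bad ≡ ∅` ⇒ every fine point qualifies, typer's `towerRegion_eq_univ_of_no_bad`), **`exists_ofFields_restricted_field_ne_zero_steps`** (packaged as
    in §3 for every `K`, with `HEq D.θ (thetaOf Q P bad K)`).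
HONEST SCOPE.  The multi-step instances of §4 carry the physically trivial tower `A_k ≡ v` (all block fields equal), for which the slice conjunct holds
with room; a non-constant multi-step instance is not attempted.  The point `x` over `Λ₂^{(K−1)}` is a hypothesis in general and automatic for `bad ≡ ∅`
(`ofFieldsConst_field_ne_zero_noBad`).  No row head changes (owner r02).  Nothing here is summit progress.
-/

noncomputable section

open Finset Real
open scoped BigOperators

namespace Literature.MathematicalPhysics.QuantumFieldTheory.Balaban1983to89.B2Eq245ThetaNonzero

open Literature.MathematicalPhysics.QuantumFieldTheory.Balaban1983to89.HiggsLattice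
open Literature.MathematicalPhysics.QuantumFieldTheory.Balaban1983to89.HiggsAveraging
open Literature.MathematicalPhysics.QuantumFieldTheory.Balaban1983to89.B2Eq337ScalarIntegration
open Literature.MathematicalPhysics.QuantumFieldTheory.Balaban1983to89.B2Eq328ConcretePieces
open Literature.MathematicalPhysics.QuantumFieldTheory.Balaban1983to89.B2Prop31ZeroFieldConcrete
open Literature.MathematicalPhysics.QuantumFieldTheory.Balaban1983to89.B2Eq324NestedRegions
open Literature.MathematicalPhysics.QuantumFieldTheory.Balaban1983to89.B2Eq32FieldRegularity
open Literature.MathematicalPhysics.QuantumFieldTheory.Balaban1983to89.B2Prop31Thresholds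
open Literature.MathematicalPhysics.QuantumFieldTheory.Balaban1983to89.B2Prop31PrintedRestrictions
open Literature.MathematicalPhysics.QuantumFieldTheory.Balaban1983to89.B3MultiscaleFields (toSite ofSite zeroCharge toSite_ofSite)
open Literature.MathematicalPhysics.QuantumFieldTheory.Balaban1983to89.B2Lemma23HiggsLattice (cutMin)
open Literature.MathematicalPhysics.QuantumFieldTheory.Balaban1983to89.B1Eq211ZeroFieldTorus (Shape)
open Literature.MathematicalPhysics.QuantumFieldTheory.Balaban1983to89.B2Prop31MinimizerFamily (MinConsts Lemma23Bounds exists_lemma23Bounds)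
open Literature.MathematicalPhysics.QuantumFieldTheory.Balaban1983to89.B2Prop31MinimizerWitness (chargeW thrQ_nonneg kappaW kappaW_nonneg)
open Literature.MathematicalPhysics.QuantumFieldTheory.Balaban1983to89.B2Prop31MinimizerWitness2 (thr217M_nonneg)
open Literature.MathematicalPhysics.QuantumFieldTheory.Balaban1983to89.B2Eq244Cutoff (zeta244)
open Literature.MathematicalPhysics.QuantumFieldTheory.Balaban1983to89.B2Eq243RegionsTower
  (towerRegion towerRegion_antitone towerRegion_blockOf_congr towerRegion_eq_univ_of_no_bad)
open Literature.MathematicalPhysics.QuantumFieldTheory.Balaban1983to89.B2Eq28RegionsCollars (prime_mono)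
open Literature.MathematicalPhysics.QuantumFieldTheory.Balaban1983to89.B2Prop31MinimizerRegions (towerRad towerRad_nonneg)
open Literature.MathematicalPhysics.QuantumFieldTheory.Balaban1983to89.B2Prop31MinimizerRegionsNonzero (norm_cutMin_const_sub_lt_rad)
open Literature.MathematicalPhysics.QuantumFieldTheory.Balaban1983to89.B2Prop31MinimizerRegionsN
  (RegionsDataN dataTowerN radN R_pos_ofN exp_neg_delta_radN_le six_le_radN L2OfN)
open Literature.MathematicalPhysics.QuantumFieldTheory.Balaban1983to89.B2Eq245Theta
  (thetaOf thetaOf_eq_one_of_mem mem_plateau thetaOf_above)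

variable {n : ℕ} {Q : B2.Params} {Γ : MinConsts} {M : ℕ} {m2 : ℝ}

/-! ## §1 The top scale of (3.2) for the constructed datum -/

section Top

variable (hn1 : 1 ≤ n) (hn2 : n ≤ 2) (P : HiggsLattice.Params) (hPL : P.L = Q.L) (hPd : P.d = Q.d) (hPM : P.M = M) (S : Shape P)
  (N K : ℕ) (hK : K ≤ P.K) (hε₀ : P.mesh K ≤ Γ.ε₀) (hmesh1 : P.mesh K ≤ 1) (hRn : (P.L : ℝ) / n * (2 * (P.M : ℝ) + 8) ≤ Q.R) (hr : 1 ≤ Q.r)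
  (hcθ : 1 ≤ Γ.cθ * (P.M : ℝ)) (bad : (j : ℕ) → Set (HiggsLattice.Site P j)) (C : ChargeData N) (hCe : C.e = Γ.e)
  (A₀ : HiggsLattice.VecField P 0) (Ac : (k : ℕ) → HiggsLattice.VecField P k) (Φ : Cfg (dataTowerN n hn1 Q P hRn hr bad K).regions N)

/-- **Where `θ_K(b₋) = 1` the §3 field IS the top (3.3) minimizer** `a_K(Lᴷε)^{−2}ζ^{(K)}G_KQ_K^*A_K` at the radius `ρ_K^{(n)}` (`1 ≤ K`; the scales
`< K` of (3.2) drop out by the nesting `θ_{j+1}θ_j = θ_{j+1}`). [cite: Balaban1982Higgs2, (3.2)–(3.3) p.583, (3.23) p.588] -/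
theorem ofFields_field_eq_top (hK1 : 1 ≤ K) (b : HiggsLattice.PBond P 0) (h1 : thetaOf Q P bad K K b.src = 1) :
    (RegionsDataN.ofFields (Γ := Γ) (m2 := m2) hn1 hn2 P hPL hPd hPM S N K hK hε₀ hmesh1 hRn hr hcθ bad C hCe A₀ Ac Φ).toRMultiMRN.field b
      = cutMin (zeroCharge P.d) Γ.μ0sq Q.a K (zeta244 P K (radN n Q.R Q.r P K)) (toSite (Ac K)) b.src b.dir := by
  set D := RegionsDataN.ofFields (Γ := Γ) (m2 := m2) hn1 hn2 P hPL hPd hPM S N K hK hε₀ hmesh1 hRn hr hcθ bad C hCe A₀ Ac Φ with hD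
  show field32 (thetaOf Q P bad K) A₀ D.toRMultiMRN.A K b = _
  rw [field32_eq_top (thetaOf Q P bad K) A₀ _ D.θ_nested hK1 b h1]
  rfl

/-- **On `B^{K−1}(Λ₂^{(K−1)})` (where print's `θ_K = 1`) the §3 field is the top minimizer.** [cite: Balaban1982Higgs2, p.567, (3.2)–(3.3) p.583] -/
theorem ofFields_field_plateau {i : ℕ} (hKi : K = i + 1) (b : HiggsLattice.PBond P 0)
    (hb : blockIter i b.src ∈ towerRegion bad (towerRad Q P) i 2) :
    (RegionsDataN.ofFields (Γ := Γ) (m2 := m2) hn1 hn2 P hPL hPd hPM S N K hK hε₀ hmesh1 hRn hr hcθ bad C hCe A₀ Ac Φ).toRMultiMRN.field b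
      = cutMin (zeroCharge P.d) Γ.μ0sq Q.a K (zeta244 P K (radN n Q.R Q.r P K)) (toSite (Ac K)) b.src b.dir := by
  subst hKi
  exact ofFields_field_eq_top hn1 hn2 P hPL hPd hPM S N (i + 1) hK hε₀ hmesh1 hRn hr hcθ bad C hCe A₀ Ac Φ (by omega) b
    (thetaOf_eq_one_of_mem le_rfl (mem_plateau.mpr hb))

end Top

/-! ## §2 The one-step datum with a constant block field: restrictions and a non-zero field -/

section K1

variable (hn1 : 1 ≤ n) (hn2 : n ≤ 2) (hΓ : Γ.Valid) (P : HiggsLattice.Params) (hPL : P.L = Q.L) (hPd : P.d = Q.d) (hPM : P.M = M) (S : Shape P)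
  (hK1 : 1 ≤ P.K) (hε₀ : P.mesh 1 ≤ Γ.ε₀) (hRn : (P.L : ℝ) / n * (2 * (P.M : ℝ) + 8) ≤ Q.R) (hr : 1 ≤ Q.r) (hcθ : 1 ≤ Γ.cθ * (P.M : ℝ))
  (bad : (j : ℕ) → Set (HiggsLattice.Site P j)) (v : EuclideanSpace ℝ (Fin P.d))

/-- **The one-step constructed datum (`K = 1`, `θ₁ = thetaOf`, `A₀ = 0`, `A₁ ≡ v`, `Φ = 0`) IS RESTRICTED** once `‖v‖ ≤ c_{A1}(Lε)^{−d/2}p(Lε)`: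
(2.55)₂ by the bound on `v`, (2.55)₁ trivially (constant field), the `θ₂`-slice conjunct vacuously (`θ₂ = 0` above `K`), (2.55)₄ for `Φ = 0`.
[cite: Balaban1982Higgs2, Prop. 3.1 p.589, (2.55) p.570, (2.17) p.560, (3.15) p.586] -/
theorem ofFieldsK1_restrictedM (hv : ‖v‖ ≤ Γ.thrA P.d (P.mesh 1)) :
    (RegionsDataN.ofFields (Γ := Γ) (m2 := m2) hn1 hn2 P hPL hPd hPM S 1 1 hK1 hε₀ (hε₀.trans hΓ.ε₀_le_one) hRn hr hcθ bad
      (chargeW Γ.e) rfl 0 (fun k => ofSite fun _ : HiggsLattice.Site P k => v) 0).toRMultiMRN.restrictedM := by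
  have hs1 : P.mesh 1 ≤ 1 := hε₀.trans hΓ.ε₀_le_one
  refine ⟨?_, ?_, ?_, ?_⟩
  · intro k hk1 hk y' _
    change k ≤ 1 at hk
    obtain rfl : k = 1 := le_antisymm hk hk1
    show ‖toSite (ofSite fun _ : HiggsLattice.Site P 1 => v) y'‖ ≤ Γ.thrA P.d (P.mesh 1)
    rw [toSite_ofSite]
    exact hv
  · intro k hk1 hk y _ y' _
    change k ≤ 1 at hk
    obtain rfl : k = 1 := le_antisymm hk hk1
    show ‖toSite (ofSite fun _ : HiggsLattice.Site P 1 => v) y' - toSite (ofSite fun _ : HiggsLattice.Site P 1 => v) y‖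
      ≤ Γ.thrQ P.d (P.mesh 1) * (Γ.r₁ + Γ.r₂ * (HiggsLattice.Site.tdist y y' : ℝ))
    rw [toSite_ofSite, sub_self, norm_zero]
    have h1 := thrQ_nonneg hΓ (P.mesh_pos 1) hs1 P.d
    have h2 := hΓ.r₁_nonneg
    have h3 := hΓ.r₂_nonneg
    positivity
  · intro j z _ μ ν hsl
    exfalso
    have hj : 1 < j.val + 2 := by omega
    rcases hsl with h | h
    · exact h (thetaOf_above (Q := Q) (P := P) (bad := bad) (K := 1) hj z)
    · exact h (thetaOf_above (Q := Q) (P := P) (bad := bad) (K := 1) hj (z.shift ν))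
  · intro j y
    show ‖(0 : V 1)‖ ≤ _
    rw [norm_zero]
    have hj : j.val = 0 := by
      have h := j.isLt
      change j.val < 1 at h
      omega
    have hsj : 0 < P.mesh (j.val + 1) ∧ P.mesh (j.val + 1) ≤ 1 := by rw [hj]; exact ⟨P.mesh_pos 1, hs1⟩
    unfold MinConsts.thrφM
    have hp : 0 ≤ B2.pFn Γ.b₀ Γ.p (P.mesh (j.val + 1)) :=
      pFn_nonneg' (Γ := Γ.toConsts 0 0) (MinConsts.toConsts_valid hΓ le_rfl le_rfl) hsj.1 hsj.2
    have := hΓ.cφ_nonneg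
    have := hΓ.lam_pos
    have : 0 ≤ Γ.lam ^ (-(1 / 4 : ℝ)) := Real.rpow_nonneg hΓ.lam_pos.le _
    have : 0 ≤ P.mesh (j.val + 1) ^ (-(P.d : ℝ) / 4) := Real.rpow_nonneg hsj.1.le _
    positivity

/-- **On `Λ₂^{(0)}` the field of the one-step datum is its (3.3) minimizer** (`θ₁ = 1` there). [cite: Balaban1982Higgs2, (3.2)–(3.3) p.583, p.567] -/
theorem ofFieldsK1_field_apply (b : HiggsLattice.PBond P 0) (hb : b.src ∈ towerRegion bad (towerRad Q P) 0 2) :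
    (RegionsDataN.ofFields (Γ := Γ) (m2 := m2) hn1 hn2 P hPL hPd hPM S 1 1 hK1 hε₀ (hε₀.trans hΓ.ε₀_le_one) hRn hr hcθ bad
      (chargeW Γ.e) rfl 0 (fun k => ofSite fun _ : HiggsLattice.Site P k => v) 0).toRMultiMRN.field b
      = cutMin (zeroCharge P.d) Γ.μ0sq Q.a 1 (zeta244 P 1 (radN n Q.R Q.r P 1)) (fun _ => v) b.src b.dir := by
  rw [ofFields_field_plateau hn1 hn2 P hPL hPd hPM S 1 1 hK1 hε₀ (hε₀.trans hΓ.ε₀_le_one) hRn hr hcθ bad (chargeW Γ.e) rfl 0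
    (fun k => ofSite fun _ : HiggsLattice.Site P k => v) 0 (i := 0) rfl b hb, toSite_ofSite]

/-- **THE FIELD OF THE ONE-STEP CONSTRUCTED DATUM IS NOT ZERO** whenever some fine point lies in `Λ₂^{(0)}`, `v ≠ 0`, `κ·Lε < 1` and
`R ≥ (L/n)(2/δ + 2M + 2)` (p320224's Lemma 2.3 with `q = 0` at the radius `ρ₁^{(n)}`, fed with the instance's own `ζ`-clauses, `L2_sub`, `nbhd`).
[cite: Balaban1982Higgs2, Prop. 3.1 p.589, (3.2)–(3.3) p.583, Lemma 2.3 p.571, (2.8) p.558] -/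
theorem ofFieldsK1_field_ne_zero (hQa : 0 < Q.a) {δ C₁ C₂ : ℝ} (pkg : Lemma23Bounds Q.d Q.L Q.a Γ.μ0sq Γ.ε₀ δ C₁ C₂) (hδ : 0 < δ)
    (hC₂ : 0 ≤ C₂) (hRδ : (P.L : ℝ) / n * (2 / δ + 2 * (P.M : ℝ) + 2) ≤ Q.R) (hsmall : kappaW Q.a Q.L Γ.μ0sq C₂ * P.mesh 1 < 1)
    (hv : v ≠ 0) {x : HiggsLattice.Site P 0} (hx : x ∈ towerRegion bad (towerRad Q P) 0 2) :
    (RegionsDataN.ofFields (Γ := Γ) (m2 := m2) hn1 hn2 P hPL hPd hPM S 1 1 hK1 hε₀ (hε₀.trans hΓ.ε₀_le_one) hRn hr hcθ bad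
      (chargeW Γ.e) rfl 0 (fun k => ofSite fun _ : HiggsLattice.Site P k => v) 0).toRMultiMRN.field ≠ 0 := by
  intro h0
  set D := RegionsDataN.ofFields (Γ := Γ) (m2 := m2) hn1 hn2 P hPL hPd hPM S 1 1 hK1 hε₀ (hε₀.trans hΓ.ε₀_le_one) hRn hr hcθ bad
      (chargeW Γ.e) rfl 0 (fun k => ofSite fun _ : HiggsLattice.Site P k => v) 0 with hD
  have hs1 : P.mesh 1 ≤ 1 := hε₀.trans hΓ.ε₀_le_one
  have hE : Real.exp (-(δ * (radN n Q.R Q.r P 1 / 2))) ≤ P.mesh 1 := exp_neg_delta_radN_le hn1 le_rfl hs1 hδ hRδ hr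
  have hρ0 : 0 ≤ radN n Q.R Q.r P 1 := by
    have h6 : 6 ≤ radN n Q.R Q.r P 1 := six_le_radN hn1 le_rfl hs1 hRn hr
    linarith
  -- `x ∈ Λ₂^{(0)}` (a union of blocks) ⇒ `x₁ ∈ (Λ₂^{(0)})′ ⊆ (Λ_{n−1}^{(0)})′ = L2 1`
  have hx' : blockIter 1 x ∈ D.toRMultiMRN.L2 1 := by
    show HiggsLattice.blockOf x ∈ prime (towerRegion bad (towerRad Q P) 0 (n - 1))
    have hr0 : 0 ≤ towerRad Q P 0 := towerRad_nonneg (R_pos_ofN hn1 hRn).le (zero_le_one.trans hr) P 0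
    refine prime_mono (towerRegion_antitone hr0 (show n - 1 ≤ 2 by omega)) ((mem_prime _ _).mpr fun x' hx'' => ?_)
    exact (towerRegion_blockOf_congr 0 2 hx'').mpr hx
  have hlt := norm_cutMin_const_sub_lt_rad hQa hΓ.μ0sq_pos pkg hC₂ S hPd hPL (k := 1) le_rfl hK1 hε₀ hs1 hρ0 hE
    (zeta244 P 1 (radN n Q.R Q.r P 1)) (D.toRMultiMRN.ζ_abs 1 le_rfl le_rfl) (D.toRMultiMRN.ζ_supp 1 le_rfl le_rfl)
    (D.toRMultiMRN.ζ_one 1 le_rfl le_rfl) (D.toRMultiMRN.ζ_lip 1 le_rfl le_rfl) (D.toRMultiMRN.L1 1) (D.toRMultiMRN.L2 1)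
    (D.toRMultiMRN.L2_sub 1) (D.toRMultiMRN.nbhd 1 le_rfl le_rfl) hsmall hv x hx'
  have hne : cutMin (zeroCharge P.d) Γ.μ0sq Q.a 1 (zeta244 P 1 (radN n Q.R Q.r P 1)) (fun _ => v) x ≠ 0 := by
    intro hz
    rw [hz, zero_sub, norm_neg] at hlt
    exact lt_irrefl _ hlt
  apply hne
  ext μ
  -- evaluate `field = 0` at the bond `⟨x, μ⟩` of the data's torus (bond typed over `P`, so that the rewrite below is syntactic)
  have hb : D.toRMultiMRN.field (⟨x, μ⟩ : HiggsLattice.PBond P 0) = 0 := by rw [h0]; rfl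
  rw [ofFieldsK1_field_apply hn1 hn2 hΓ P hPL hPd hPM S hK1 hε₀ hRn hr hcθ bad v ⟨x, μ⟩ hx] at hb
  rw [hb]
  rfl

end K1

/-! ## §3 Packaged: the constructed family with `θ` constructed is inhabited with restrictions and a non-zero field -/

/-- **NON-VACUITY OF THE FULLY CONSTRUCTED FAMILY** (`1 ≤ n ≤ 2`, `c_θ·M ≥ 1`): there are `R₁, s₁ > 0` (`s₁ ≤ ε₀`) such that for every parameter
set with `d, L, a` fixed, `R ≥ R₁`, `r ≥ 1`, every torus of the sub-family with `M`-blocks, `K ≥ 1`, `Lε ≤ s₁`, every large-field configuration,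
every `v` with `‖v‖ ≤ c_{A1}(Lε)^{−d/2}p(Lε)`, `v ≠ 0`, and every fine point of `Λ₂^{(0)}`, the datum `RegionsDataN.ofFields` on that torus with `K = 1`,
`θ = thetaOf` (print's θ_k constructed), regions = the (2.7)–(2.8) tower, satisfies the printed restrictions AND has a non-zero §3 field.
[cite: Balaban1982Higgs2, Prop. 3.1 p.589, (3.2)–(3.3) p.583, p.567, Lemma 2.3 p.571, (2.55) p.570, (2.7)–(2.8) p.558] -/
theorem exists_ofFields_restricted_field_ne_zero (n : ℕ) (hn1 : 1 ≤ n) (hn2 : n ≤ 2) (d L M : ℕ) (hd : 1 ≤ d) (hL : Odd L ∧ 1 < L) {a : ℝ}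
    (ha : 0 < a) (Γ : MinConsts) (hΓ : Γ.Valid) (hcθ : 1 ≤ Γ.cθ * (M : ℝ)) :
    ∃ R₁ s₁ : ℝ, 0 < R₁ ∧ 0 < s₁ ∧ s₁ ≤ Γ.ε₀ ∧
      ∀ (Q : B2.Params), Q.d = d → Q.L = L → Q.a = a → R₁ ≤ Q.R → 1 ≤ Q.r → ∀ (m2 : ℝ)
        (P : HiggsLattice.Params) (_S : Shape P), P.d = d → P.L = L → P.M = M → 1 ≤ P.K → P.mesh 1 ≤ s₁ →
        ∀ (bad : (j : ℕ) → Set (HiggsLattice.Site P j)) (v : EuclideanSpace ℝ (Fin P.d)), ‖v‖ ≤ Γ.thrA P.d (P.mesh 1) → v ≠ 0 →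
        ∀ x : HiggsLattice.Site P 0, x ∈ towerRegion bad (towerRad Q P) 0 2 →
          ∃ D : RegionsDataN n Q Γ M m2, D.P = P ∧ D.K = 1 ∧ HEq D.θ (thetaOf Q P bad 1) ∧
            D.toRMultiMRN.restrictedM ∧ D.toRMultiMRN.field ≠ 0 := by
  obtain ⟨δ, C₁, C₂, hδ, hC₁, hC₂, pkg⟩ := exists_lemma23Bounds d L hd hL ha hΓ.μ0sq_pos Γ.ε₀
  set κ : ℝ := kappaW a L Γ.μ0sq C₂ with hκ
  have hκ0 : 0 ≤ κ := kappaW_nonneg ha hL.2 hΓ.μ0sq_pos.le hC₂.le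
  have hLpos : (0 : ℝ) < (L : ℝ) := by exact_mod_cast (lt_trans Nat.zero_lt_one hL.2)
  have hnpos : (0 : ℝ) < (n : ℝ) := by exact_mod_cast (lt_of_lt_of_le Nat.zero_lt_one hn1)
  refine ⟨(L : ℝ) / n * (2 / δ + 2 * (M : ℝ) + 8), min Γ.ε₀ (1 / (2 * (κ + 1))), by positivity,
    lt_min hΓ.ε₀_pos (by positivity), min_le_left _ _, ?_⟩
  intro Q hQd hQL hQa hR hr m2 P S hPd hPL hPM hK1 hs bad v hv hv0 x hx
  subst hQd hQL hQa
  have hR8 : (P.L : ℝ) / n * (2 * (P.M : ℝ) + 8) ≤ Q.R := by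
    rw [hPL, hPM]
    have : (Q.L : ℝ) / n * (2 * (M : ℝ) + 8) ≤ (Q.L : ℝ) / n * (2 / δ + 2 * (M : ℝ) + 8) := by
      apply mul_le_mul_of_nonneg_left _ (by positivity)
      have : 0 < 2 / δ := by positivity
      linarith
    exact this.trans hR
  have hRδ : (P.L : ℝ) / n * (2 / δ + 2 * (P.M : ℝ) + 2) ≤ Q.R := by
    rw [hPL, hPM]
    have : (Q.L : ℝ) / n * (2 / δ + 2 * (M : ℝ) + 2) ≤ (Q.L : ℝ) / n * (2 / δ + 2 * (M : ℝ) + 8) :=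
      mul_le_mul_of_nonneg_left (by linarith) (by positivity)
    exact this.trans hR
  have hε₀ : P.mesh 1 ≤ Γ.ε₀ := hs.trans (min_le_left _ _)
  have hcθ' : 1 ≤ Γ.cθ * (P.M : ℝ) := by rw [hPM]; exact hcθ
  have hsmall : kappaW Q.a Q.L Γ.μ0sq C₂ * P.mesh 1 < 1 := by
    rw [← hκ]
    have h1 : P.mesh 1 ≤ 1 / (2 * (κ + 1)) := hs.trans (min_le_right _ _)
    have h2 : κ * P.mesh 1 ≤ κ * (1 / (2 * (κ + 1))) := mul_le_mul_of_nonneg_left h1 hκ0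
    have h3 : κ * (1 / (2 * (κ + 1))) < 1 := by
      rw [mul_one_div, div_lt_one (by positivity)]
      linarith
    linarith
  refine ⟨RegionsDataN.ofFields (Γ := Γ) (m2 := m2) hn1 hn2 P hPL hPd hPM S 1 1 hK1 hε₀ (hε₀.trans hΓ.ε₀_le_one) hR8 hr hcθ' bad
      (chargeW Γ.e) rfl 0 (fun k => ofSite fun _ : HiggsLattice.Site P k => v) 0, rfl, rfl, HEq.rfl,
    ofFieldsK1_restrictedM hn1 hn2 hΓ P hPL hPd hPM S hK1 hε₀ hR8 hr hcθ' bad v hv, ?_⟩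
  exact ofFieldsK1_field_ne_zero hn1 hn2 hΓ P hPL hPd hPM S hK1 hε₀ hR8 hr hcθ' bad v ha pkg hδ hC₂.le hRδ hsmall hv0 hx


/-! ## §4 (v1.1) Every number of steps: the constant tower of block fields -/

section ConstK

variable (hn1 : 1 ≤ n) (hn2 : n ≤ 2) (hΓ : Γ.Valid) (P : HiggsLattice.Params) (hPL : P.L = Q.L) (hPd : P.d = Q.d) (hPM : P.M = M) (S : Shape P)
  (K : ℕ) (hK : K ≤ P.K) (hε₀ : P.mesh K ≤ Γ.ε₀) (hRn : (P.L : ℝ) / n * (2 * (P.M : ℝ) + 8) ≤ Q.R) (hr : 1 ≤ Q.r) (hcθ : 1 ≤ Γ.cθ * (P.M : ℝ))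
  (bad : (j : ℕ) → Set (HiggsLattice.Site P j)) (v : EuclideanSpace ℝ (Fin P.d))

/-- **THE `K`-STEP CONSTRUCTED DATUM WITH `A_k ≡ v` IS RESTRICTED** once `‖v‖ ≤ c_{A1}(Lᵏε)^{−d/2}p(Lᵏε)` for `k ≤ K`: (2.55)₂ by the bounds on `v`,
(2.55)₁ of a constant is `0`, the (2.17)-type clause on the `θ_{j+2}`-slices of the CONSTRUCTED `θ` reads `|v_μ − v_μ| = 0 ≤ thr217(L^{j+1}ε)`, `Φ = 0`.
[cite: Balaban1982Higgs2, Prop. 3.1 p.589, (2.55) p.570, (2.17) p.560, (3.15) p.586] -/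
theorem ofFieldsConst_restrictedM (hv : ∀ k, 1 ≤ k → k ≤ K → ‖v‖ ≤ Γ.thrA P.d (P.mesh k)) :
    (RegionsDataN.ofFields (Γ := Γ) (m2 := m2) hn1 hn2 P hPL hPd hPM S 1 K hK hε₀ (hε₀.trans hΓ.ε₀_le_one) hRn hr hcθ bad
      (chargeW Γ.e) rfl 0 (fun k => ofSite fun _ : HiggsLattice.Site P k => v) 0).toRMultiMRN.restrictedM := by
  have hsK : P.mesh K ≤ 1 := hε₀.trans hΓ.ε₀_le_one
  have hsk : ∀ {k : ℕ}, k ≤ K → 0 < P.mesh k ∧ P.mesh k ≤ 1 := fun hk => ⟨P.mesh_pos _, (mesh_le_mesh hk).trans hsK⟩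
  refine ⟨?_, ?_, ?_, ?_⟩
  · intro k hk1 hk y' _
    change k ≤ K at hk
    show ‖toSite (ofSite fun _ : HiggsLattice.Site P k => v) y'‖ ≤ Γ.thrA P.d (P.mesh k)
    rw [toSite_ofSite]
    exact hv k hk1 hk
  · intro k hk1 hk y _ y' _
    change k ≤ K at hk
    show ‖toSite (ofSite fun _ : HiggsLattice.Site P k => v) y' - toSite (ofSite fun _ : HiggsLattice.Site P k => v) y‖
      ≤ Γ.thrQ P.d (P.mesh k) * (Γ.r₁ + Γ.r₂ * (HiggsLattice.Site.tdist y y' : ℝ))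
    rw [toSite_ofSite, sub_self, norm_zero]
    have h1 := thrQ_nonneg hΓ (hsk hk).1 (hsk hk).2 P.d
    have h2 := hΓ.r₁_nonneg
    have h3 := hΓ.r₂_nonneg
    positivity
  · intro j z _ μ ν _
    have hj : j.val + 1 ≤ K := by have h := j.isLt; change j.val < K at h; omega
    show |v μ - v μ| ≤ Γ.thr217M P.d (P.mesh (j.val + 1))
    rw [sub_self, abs_zero]
    exact thr217M_nonneg hΓ (hsk hj).1 (hsk hj).2 P.d
  · intro j y
    show ‖(0 : V 1)‖ ≤ _
    rw [norm_zero]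
    have hj : j.val + 1 ≤ K := by have h := j.isLt; change j.val < K at h; omega
    unfold MinConsts.thrφM
    have hp : 0 ≤ B2.pFn Γ.b₀ Γ.p (P.mesh (j.val + 1)) :=
      pFn_nonneg' (Γ := Γ.toConsts 0 0) (MinConsts.toConsts_valid hΓ le_rfl le_rfl) (hsk hj).1 (hsk hj).2
    have := hΓ.cφ_nonneg
    have : 0 ≤ Γ.lam ^ (-(1 / 4 : ℝ)) := Real.rpow_nonneg hΓ.lam_pos.le _
    have : 0 ≤ P.mesh (j.val + 1) ^ (-(P.d : ℝ) / 4) := Real.rpow_nonneg (hsk hj).1.le _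
    positivity

/-- **On `B^{K−1}(Λ₂^{(K−1)})` the field of the `K`-step datum is its level-`K` (3.3) minimizer** (`θ_K = 1` there). [cite: Balaban1982Higgs2, (3.2)–(3.3) p.583, p.567] -/
theorem ofFieldsConst_field_apply {i : ℕ} (hKi : K = i + 1) (b : HiggsLattice.PBond P 0)
    (hb : blockIter i b.src ∈ towerRegion bad (towerRad Q P) i 2) :
    (RegionsDataN.ofFields (Γ := Γ) (m2 := m2) hn1 hn2 P hPL hPd hPM S 1 K hK hε₀ (hε₀.trans hΓ.ε₀_le_one) hRn hr hcθ bad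
      (chargeW Γ.e) rfl 0 (fun k => ofSite fun _ : HiggsLattice.Site P k => v) 0).toRMultiMRN.field b
      = cutMin (zeroCharge P.d) Γ.μ0sq Q.a K (zeta244 P K (radN n Q.R Q.r P K)) (fun _ => v) b.src b.dir := by
  rw [ofFields_field_plateau hn1 hn2 P hPL hPd hPM S 1 K hK hε₀ (hε₀.trans hΓ.ε₀_le_one) hRn hr hcθ bad (chargeW Γ.e) rfl 0
    (fun k => ofSite fun _ : HiggsLattice.Site P k => v) 0 hKi b hb, toSite_ofSite]

/-- **THE FIELD OF THE `K`-STEP CONSTRUCTED DATUM IS NOT ZERO** whenever some fine point lies in `B^{K−1}(Λ₂^{(K−1)})`, `v ≠ 0`, `κ·Lᴷε < 1` and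
`R ≥ (L/n)(2/δ + 2M + 2)` (p320224's Lemma 2.3 with `q = 0` at the level `K` and the radius `ρ_K^{(n)}`, fed with the instance's own `ζ`-clauses,
`L2_sub`, `nbhd`). [cite: Balaban1982Higgs2, Prop. 3.1 p.589, (3.2)–(3.3) p.583, Lemma 2.3 p.571, (2.8) p.558] -/
theorem ofFieldsConst_field_ne_zero (hQa : 0 < Q.a) {δ C₁ C₂ : ℝ} (pkg : Lemma23Bounds Q.d Q.L Q.a Γ.μ0sq Γ.ε₀ δ C₁ C₂) (hδ : 0 < δ)
    (hC₂ : 0 ≤ C₂) (hRδ : (P.L : ℝ) / n * (2 / δ + 2 * (P.M : ℝ) + 2) ≤ Q.R) (hsmall : kappaW Q.a Q.L Γ.μ0sq C₂ * P.mesh K < 1)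
    (hv : v ≠ 0) {i : ℕ} (hKi : K = i + 1) {x : HiggsLattice.Site P 0} (hx : blockIter i x ∈ towerRegion bad (towerRad Q P) i 2) :
    (RegionsDataN.ofFields (Γ := Γ) (m2 := m2) hn1 hn2 P hPL hPd hPM S 1 K hK hε₀ (hε₀.trans hΓ.ε₀_le_one) hRn hr hcθ bad
      (chargeW Γ.e) rfl 0 (fun k => ofSite fun _ : HiggsLattice.Site P k => v) 0).toRMultiMRN.field ≠ 0 := by
  intro h0
  set D := RegionsDataN.ofFields (Γ := Γ) (m2 := m2) hn1 hn2 P hPL hPd hPM S 1 K hK hε₀ (hε₀.trans hΓ.ε₀_le_one) hRn hr hcθ bad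
      (chargeW Γ.e) rfl 0 (fun k => ofSite fun _ : HiggsLattice.Site P k => v) 0 with hD
  have hK1 : 1 ≤ K := by omega
  have hs1 : P.mesh K ≤ 1 := hε₀.trans hΓ.ε₀_le_one
  have hE : Real.exp (-(δ * (radN n Q.R Q.r P K / 2))) ≤ P.mesh K := exp_neg_delta_radN_le hn1 hK1 hs1 hδ hRδ hr
  have hρ0 : 0 ≤ radN n Q.R Q.r P K := by
    have h6 : 6 ≤ radN n Q.R Q.r P K := six_le_radN hn1 hK1 hs1 hRn hr
    linarith
  -- `x_{K−1} ∈ Λ₂^{(K−1)}` (a union of blocks) ⇒ `x_K ∈ (Λ₂^{(K−1)})′ ⊆ (Λ_{n−1}^{(K−1)})′ = L2 K`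
  have hx' : blockIter K x ∈ D.toRMultiMRN.L2 K := by
    subst hKi
    show HiggsLattice.blockOf (blockIter i x) ∈ prime (towerRegion bad (towerRad Q P) i (n - 1))
    have hr0 : 0 ≤ towerRad Q P i := towerRad_nonneg (R_pos_ofN hn1 hRn).le (zero_le_one.trans hr) P i
    refine prime_mono (towerRegion_antitone hr0 (show n - 1 ≤ 2 by omega)) ((mem_prime _ _).mpr fun x' hx'' => ?_)
    exact (towerRegion_blockOf_congr i 2 hx'').mpr hx
  have hlt := norm_cutMin_const_sub_lt_rad hQa hΓ.μ0sq_pos pkg hC₂ S hPd hPL (k := K) hK1 hK hε₀ hs1 hρ0 hE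
    (zeta244 P K (radN n Q.R Q.r P K)) (D.toRMultiMRN.ζ_abs K hK1 le_rfl) (D.toRMultiMRN.ζ_supp K hK1 le_rfl)
    (D.toRMultiMRN.ζ_one K hK1 le_rfl) (D.toRMultiMRN.ζ_lip K hK1 le_rfl) (D.toRMultiMRN.L1 K) (D.toRMultiMRN.L2 K)
    (D.toRMultiMRN.L2_sub K) (D.toRMultiMRN.nbhd K hK1 le_rfl) hsmall hv x hx'
  have hne : cutMin (zeroCharge P.d) Γ.μ0sq Q.a K (zeta244 P K (radN n Q.R Q.r P K)) (fun _ => v) x ≠ 0 := by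
    intro hz
    rw [hz, zero_sub, norm_neg] at hlt
    exact lt_irrefl _ hlt
  apply hne
  ext μ
  have hb : D.toRMultiMRN.field (⟨x, μ⟩ : HiggsLattice.PBond P 0) = 0 := by rw [h0]; rfl
  rw [ofFieldsConst_field_apply hn1 hn2 hΓ P hPL hPd hPM S K hK hε₀ hRn hr hcθ bad v hKi ⟨x, μ⟩ hx] at hb
  rw [hb]
  rfl

/-- **With NO large-field points** (`bad ≡ ∅`, the leading small-field term of the expansion (2.9)) every `Λ_i^{(j)}` is the whole lattice
(typer's `towerRegion_eq_univ_of_no_bad`), so the `K`-step constructed datum has a non-zero field at EVERY fine point, unconditionally in `x`.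
[cite: Balaban1982Higgs2, Prop. 3.1 p.589, (2.43) p.566, (2.9) p.558] -/
theorem ofFieldsConst_field_ne_zero_noBad (hbad : ∀ j, bad j = ∅) (hQa : 0 < Q.a) {δ C₁ C₂ : ℝ}
    (pkg : Lemma23Bounds Q.d Q.L Q.a Γ.μ0sq Γ.ε₀ δ C₁ C₂) (hδ : 0 < δ) (hC₂ : 0 ≤ C₂) (hRδ : (P.L : ℝ) / n * (2 / δ + 2 * (P.M : ℝ) + 2) ≤ Q.R)
    (hsmall : kappaW Q.a Q.L Γ.μ0sq C₂ * P.mesh K < 1) (hv : v ≠ 0) {i : ℕ} (hKi : K = i + 1) (x : HiggsLattice.Site P 0) :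
    (RegionsDataN.ofFields (Γ := Γ) (m2 := m2) hn1 hn2 P hPL hPd hPM S 1 K hK hε₀ (hε₀.trans hΓ.ε₀_le_one) hRn hr hcθ bad
      (chargeW Γ.e) rfl 0 (fun k => ofSite fun _ : HiggsLattice.Site P k => v) 0).toRMultiMRN.field ≠ 0 :=
  ofFieldsConst_field_ne_zero hn1 hn2 hΓ P hPL hPd hPM S K hK hε₀ hRn hr hcθ bad v hQa pkg hδ hC₂ hRδ hsmall hv hKi (x := x)
    (by rw [towerRegion_eq_univ_of_no_bad hbad]; exact Finset.mem_univ _)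

end ConstK

/-- **NON-VACUITY OF THE FULLY CONSTRUCTED FAMILY AT EVERY NUMBER OF STEPS** (`1 ≤ n ≤ 2`, `c_θ·M ≥ 1`): there are `R₁, s₁ > 0` (`s₁ ≤ ε₀`) such
that for every parameter set with `d, L, a` fixed, `R ≥ R₁`, `r ≥ 1`, every torus of the sub-family with `M`-blocks, every `1 ≤ K ≤` the lattice's
with `Lᴷε ≤ s₁`, every large-field configuration, every `v ≠ 0` with `‖v‖ ≤ thrA(Lᵏε)` (`k ≤ K`), and every fine point of `B^{K−1}(Λ₂^{(K−1)})`, the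
`K`-step datum `RegionsDataN.ofFields` (θ = print's θ_k constructed, regions = the (2.7)–(2.8) tower, radius `ρ^{(n)}`, `A_k ≡ v`) satisfies the
printed restrictions AND has a non-zero §3 field. [cite: Balaban1982Higgs2, Prop. 3.1 p.589, (3.2)–(3.3) p.583, p.567, Lemma 2.3 p.571, (2.55) p.570, (2.7)–(2.8) p.558] -/
theorem exists_ofFields_restricted_field_ne_zero_steps (n : ℕ) (hn1 : 1 ≤ n) (hn2 : n ≤ 2) (d L M : ℕ) (hd : 1 ≤ d) (hL : Odd L ∧ 1 < L)
    {a : ℝ} (ha : 0 < a) (Γ : MinConsts) (hΓ : Γ.Valid) (hcθ : 1 ≤ Γ.cθ * (M : ℝ)) :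
    ∃ R₁ s₁ : ℝ, 0 < R₁ ∧ 0 < s₁ ∧ s₁ ≤ Γ.ε₀ ∧
      ∀ (Q : B2.Params), Q.d = d → Q.L = L → Q.a = a → R₁ ≤ Q.R → 1 ≤ Q.r → ∀ (m2 : ℝ)
        (P : HiggsLattice.Params) (_S : Shape P), P.d = d → P.L = L → P.M = M → ∀ (K : ℕ), K ≤ P.K → P.mesh K ≤ s₁ →
        ∀ (bad : (j : ℕ) → Set (HiggsLattice.Site P j)) (v : EuclideanSpace ℝ (Fin P.d)),
          (∀ k, 1 ≤ k → k ≤ K → ‖v‖ ≤ Γ.thrA P.d (P.mesh k)) → v ≠ 0 →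
        ∀ (i : ℕ), K = i + 1 → ∀ x : HiggsLattice.Site P 0, blockIter i x ∈ towerRegion bad (towerRad Q P) i 2 →
          ∃ D : RegionsDataN n Q Γ M m2, D.P = P ∧ D.K = K ∧ HEq D.θ (thetaOf Q P bad K) ∧
            D.toRMultiMRN.restrictedM ∧ D.toRMultiMRN.field ≠ 0 := by
  obtain ⟨δ, C₁, C₂, hδ, hC₁, hC₂, pkg⟩ := exists_lemma23Bounds d L hd hL ha hΓ.μ0sq_pos Γ.ε₀
  set κ : ℝ := kappaW a L Γ.μ0sq C₂ with hκ
  have hκ0 : 0 ≤ κ := kappaW_nonneg ha hL.2 hΓ.μ0sq_pos.le hC₂.le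
  have hLpos : (0 : ℝ) < (L : ℝ) := by exact_mod_cast (lt_trans Nat.zero_lt_one hL.2)
  have hnpos : (0 : ℝ) < (n : ℝ) := by exact_mod_cast (lt_of_lt_of_le Nat.zero_lt_one hn1)
  refine ⟨(L : ℝ) / n * (2 / δ + 2 * (M : ℝ) + 8), min Γ.ε₀ (1 / (2 * (κ + 1))), by positivity,
    lt_min hΓ.ε₀_pos (by positivity), min_le_left _ _, ?_⟩
  intro Q hQd hQL hQa hR hr m2 P S hPd hPL hPM K hK hs bad v hv hv0 i hKi x hx
  subst hQd hQL hQa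
  have hR8 : (P.L : ℝ) / n * (2 * (P.M : ℝ) + 8) ≤ Q.R := by
    rw [hPL, hPM]
    have : (Q.L : ℝ) / n * (2 * (M : ℝ) + 8) ≤ (Q.L : ℝ) / n * (2 / δ + 2 * (M : ℝ) + 8) := by
      apply mul_le_mul_of_nonneg_left _ (by positivity)
      have : 0 < 2 / δ := by positivity
      linarith
    exact this.trans hR
  have hRδ : (P.L : ℝ) / n * (2 / δ + 2 * (P.M : ℝ) + 2) ≤ Q.R := by
    rw [hPL, hPM]
    have : (Q.L : ℝ) / n * (2 / δ + 2 * (M : ℝ) + 2) ≤ (Q.L : ℝ) / n * (2 / δ + 2 * (M : ℝ) + 8) :=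
      mul_le_mul_of_nonneg_left (by linarith) (by positivity)
    exact this.trans hR
  have hε₀ : P.mesh K ≤ Γ.ε₀ := hs.trans (min_le_left _ _)
  have hcθ' : 1 ≤ Γ.cθ * (P.M : ℝ) := by rw [hPM]; exact hcθ
  have hsmall : kappaW Q.a Q.L Γ.μ0sq C₂ * P.mesh K < 1 := by
    rw [← hκ]
    have h1 : P.mesh K ≤ 1 / (2 * (κ + 1)) := hs.trans (min_le_right _ _)
    have h2 : κ * P.mesh K ≤ κ * (1 / (2 * (κ + 1))) := mul_le_mul_of_nonneg_left h1 hκ0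
    have h3 : κ * (1 / (2 * (κ + 1))) < 1 := by
      rw [mul_one_div, div_lt_one (by positivity)]
      linarith
    linarith
  refine ⟨RegionsDataN.ofFields (Γ := Γ) (m2 := m2) hn1 hn2 P hPL hPd hPM S 1 K hK hε₀ (hε₀.trans hΓ.ε₀_le_one) hR8 hr hcθ' bad
      (chargeW Γ.e) rfl 0 (fun k => ofSite fun _ : HiggsLattice.Site P k => v) 0, rfl, rfl, HEq.rfl,
    ofFieldsConst_restrictedM hn1 hn2 hΓ P hPL hPd hPM S K hK hε₀ hR8 hr hcθ' bad v hv, ?_⟩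
  exact ofFieldsConst_field_ne_zero hn1 hn2 hΓ P hPL hPd hPM S K hK hε₀ hR8 hr hcθ' bad v ha pkg hδ hC₂.le hRδ hsmall hv0 hKi hx

end Literature.MathematicalPhysics.QuantumFieldTheory.Balaban1983to89.B2Eq245ThetaNonzero

end
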